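import Literature.AlgebraicGeometry.Resolution.BlowupChartMembership
import Literature.AlgebraicGeometry.Resolution.BlowupChartQuasiRegular
import Literature.AlgebraicGeometry.Resolution.PermissibleCentres
import Literature.AlgebraicGeometry.Resolution.MarkedIdealsEtale
import HarnessLib

/-!
# [OURS · L1 W4.2] One chart of a blow-up over a (possibly non-closed) point: a `k(x)`-RATIONAL point of the fibre with
# prescribed ratios is unique, and its residue field is `k(x)` — scheme plumbing for the near-fibre clause of 2.14♯
# (fact-free)

Cell res-hironaka, rung L, slot W4.2 (crux chain w42 `SigmaMaxModifications`, stmt-ResolutionOfSingularities-18506;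
conjunct `SigmaMaxModificationsCorridor3`, stmt-ResolutionOfSingularities-19249), stub worker res-L1-w42-stub-3 (gen 4),
row `stub_Wlow3M_two`: discharge of the (F1♯) near-fibre binder `Moving.Theorem314_nearFibre_geomDir`. This file
generalises the PRIVATE plumbing of the tree's `Literature/AlgebraicGeometry/CossartJannsenSaito2020/ProjDirLine.lean`
(proof of `ProjDir_line`: «`ℙ(Dir_x(X)) ≅ ℙ⁰_{k(x)}` is one `k(x)`-rational point», blow-up of a CLOSED point) from a
maximal ideal `𝔭_x` to an arbitrary PRIME `𝔭_x ⊆ R = Γ(X, U)` (the point `x` of the centre need not be closed) and to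
an arbitrary centre `C` with generators `c` of `C(U)`:

* `exists_chart_of_ideal_eq_span'`, `stalkMap_stalkMap_germ_of_chart'` — copies of the private chart lemmas of
  `ProjDirLine.lean` (the chart `g_j : Spec (R[It])_{(c_j t)} → X'` for an explicit generating family `c` of `C(U)`, and
  its germs), exported for the sequel;
* `exists_sub_mem_rationalIdeal` — in `D = R[e_k]` every element `d` satisfies `ψ(σ) d − ψ(ρ) ∈ 𝔑` for some `σ ∉ 𝔭`,
  `ρ ∈ R`, where `𝔑 = 𝔭·D + (ψ(s_k) e_k − ψ(r_k))_k` is the ideal of «the point with ratios `e_k = r_k/s_k`»;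
* `eq_of_comap_eq_of_rationalIdeal_le` — hence **two primes of `D` lying over `𝔭` and containing `𝔑` COINCIDE** (for
  `𝔭` maximal `𝔑` itself is that prime, `ProjDirLine`; for `𝔭` prime it is the unique prime of `(D/𝔑) ⊗ k(𝔭) = k(𝔭)`);
* `rationalIdeal_le_of_chart` — at a point `w` of the chart lying over `𝔭` at which every ratio `c_k/c_j` takes the
  value `β_k = r_k/s_k ∈ 𝒪_{X,x} = R_𝔭` (read through `φ : R_𝔭 → 𝒪_{X',g w}` over `π^♯`): `𝔑 ≤ w`;
* `isIso_residueFieldMap_of_chart` — and then `k(x) → k(g w)` is an ISOMORPHISM (the point is `k(x)`-rational).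

Everything PROVED from the universal property of blowing up and Mathlib's `Spec`/stalk API; no facts, no `sorry`.
[OURS · L1 W4.2] kernel plumbing; NOT a statement of any source and NOT a statement of H. Hironaka's 2017 manuscript.
AI-written; AI review is weaker than expert review.

References: The Stacks Project, Tag 0804 (charts of a blowing up) [StacksProject]; V. Cossart, U. Jannsen, S. Saito,
LNM 2270 (2020), Thm. 3.14 (proof p. 51 «Proj(A_D) = π_X⁻¹(x)»), p. 103 L32 [CossartJannsenSaito2020]; tree
`ProjDirLine.lean` (res-type-031 / W4.2 P-a), `BlowupChartMembership.lean`, `BlowupChartQuasiRegular.lean`.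
-/

set_option linter.dupNamespace false

noncomputable section

open CategoryTheory AlgebraicGeometry TopologicalSpace IsLocalRing
open Literature.AlgebraicGeometry.Resolution

namespace Summit.ResolutionOfSingularities.ResolutionOfSingularities.Theorems.SigmaMaxModificationsCorridor3.Directrix214Sharp

universe u

/-! ## Plumbing: one chart of a blow-up, read for an explicit generating family of the centre's ideal -/

/-- The chart `g_j : Spec (R[It])_{(c_j t)} → X'` of a blowing up `π` along `C` over an affine open `U`, for a generating
family `c` of `I = C(U)` (so that the chart ring is literally `chartRing c j`): an open immersion over `Spec R → X` through
`chartBase c j`, containing every point at which `c_j` generates the exceptional ideal (`IsBlowup.exists_charts`,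
`IsBlowup.mem_range_chart_of_stalkIdeal_eq_span`). Copy of the private lemma of `ProjDirLine.lean`.
[cite: StacksProject, Tag 0804] -/
theorem exists_chart_of_ideal_eq_span' {X' X : Scheme.{u}} {π : X' ⟶ X} {C : X.IdealSheafData}
    (hπ : IsBlowup π C) (U : X.affineOpens) {r : ℕ} (c : Fin r → Γ(X, U))
    (hc : C.ideal U = Ideal.span (Set.range c)) (j : Fin r) :
    ∃ g : Spec (.of (chartRing c j)) ⟶ X', IsOpenImmersion g ∧
      g ≫ π = Spec.map (CommRingCat.ofHom (chartBase c j)) ≫ U.2.fromSpec ∧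
      ∀ (x' : X') (hx : π x' ∈ (U : X.Opens)),
        stalkIdeal (C.comap π) x' =
            Ideal.span {(π.stalkMap x').hom ((X.presheaf.germ U (π x') hx).hom (c j))} →
          x' ∈ Set.range g := by
  have key : ∀ (I : Ideal Γ(X, U)) (_ : C.ideal U = I) (b : Γ(X, U)) (hb : b ∈ I),
      ∃ g : Spec (.of (HomogeneousLocalization.Away (reesGrading I) (reesT b hb))) ⟶ X',
        IsOpenImmersion g ∧
        g ≫ π = Spec.map (CommRingCat.ofHom (reesChartBase b hb)) ≫ U.2.fromSpec ∧
        ∀ (x' : X') (hx : π x' ∈ (U : X.Opens)),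
          stalkIdeal (C.comap π) x' =
              Ideal.span {(π.stalkMap x').hom ((X.presheaf.germ U (π x') hx).hom b)} →
            x' ∈ Set.range g := by
    rintro I rfl b hb
    obtain ⟨g, h1, h2, -⟩ := hπ.exists_charts U
    exact ⟨g b hb, h1 b hb, h2 b hb, fun x' hx hgen =>
      hπ.mem_range_chart_of_stalkIdeal_eq_span U hb (g b hb) (h2 b hb) hx hgen⟩
  exact key _ hc (c j) (Ideal.mem_span_range_self (f := c) (x := j))

/-- On a chart `g : Spec D → X'` with `g ≫ π = Spec f ≫ (Spec Γ(X, U) → X)`: `g^♯_w ∘ π^♯_{g w} ∘ germ = (D → 𝒪_{Spec D, w}) ∘ f`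
(germs of `appLE_chart_eq`). Copy of the private lemma of `ProjDirLine.lean`. [cite: StacksProject, Tag 0804] -/
theorem stalkMap_stalkMap_germ_of_chart' {X' X : Scheme.{u}} (π : X' ⟶ X) (U : X.affineOpens)
    {D : CommRingCat.{u}} (g : Spec D ⟶ X') (f : Γ(X, U) ⟶ D)
    (hg : g ≫ π = Spec.map f ≫ U.2.fromSpec) (w : Spec D) (hx : π (g w) ∈ (U : X.Opens)) (r : Γ(X, U)) :
    (g.stalkMap w).hom ((π.stalkMap (g w)).hom ((X.presheaf.germ U (π (g w)) hx).hom r)) =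
      ((Spec D).presheaf.germ ⊤ w trivial).hom ((Scheme.ΓSpecIso D).inv.hom (f.hom r)) := by
  have e := top_le_preimage_of_chart U g f hg
  have h1 : ((Spec D).presheaf.germ ⊤ w trivial).hom ((g ≫ π).appLE U ⊤ e r) =
      ((g ≫ π).stalkMap w).hom ((X.presheaf.germ U ((g ≫ π) w) (e trivial)).hom r) := by
    change ((g ≫ π).appLE U ⊤ e ≫ (Spec D).presheaf.germ ⊤ w trivial).hom r =
      (X.presheaf.germ U ((g ≫ π) w) (e trivial) ≫ (g ≫ π).stalkMap w).hom r
    rw [Scheme.Hom.germ_stalkMap, Scheme.Hom.appLE, Category.assoc, (Spec D).presheaf.germ_res]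
  rw [appLE_chart_eq U g f hg e, Scheme.Hom.stalkMap_comp] at h1
  exact h1.symm

/-! ## The ideal `𝔑` of a rational point of a chart over a PRIME `𝔭` -/

section Rational

variable {R D : Type u} [CommRing R] [CommRing D] (ψ : R →+* D) {r : ℕ} (j : Fin r) (e : Fin r → D)
  (𝔭 : Ideal R) [𝔭.IsPrime] (rs : Fin r → R × 𝔭.primeCompl)

/-- **Every element of `D = R[e_k : k ≠ j]` is `𝔭`-rationally congruent to a scalar modulo
`𝔑 = 𝔭·D + (ψ(s_k) e_k − ψ(r_k))_k`**: for every `d ∈ D` there are `ρ ∈ R` and `σ ∈ R ∖ 𝔭` with `ψ(σ) d − ψ(ρ) ∈ 𝔑`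
(induction on a polynomial expression of `d` in the generators; `e_k ≡ r_k/s_k`). For `𝔭` maximal one may take `σ = 1`
(`ProjDirLine`); for `𝔭` prime the denominators are needed. [folklore; AI-written] -/
theorem exists_sub_mem_rationalIdeal
    (hgen : Function.Surjective (MvPolynomial.eval₂Hom ψ (fun k : {k : Fin r // k ≠ j} => e k.1))) (d : D) :
    ∃ (ρ σ : R), σ ∉ 𝔭 ∧ ψ σ * d - ψ ρ ∈ 𝔭.map ψ ⊔ Ideal.span (Set.range fun k =>
        ψ ((rs k).2 : R) * e k - ψ (rs k).1) := by
  classical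
  set 𝔑 : Ideal D := 𝔭.map ψ ⊔ Ideal.span (Set.range fun k => ψ ((rs k).2 : R) * e k - ψ (rs k).1) with h𝔑
  suffices h : ∀ P : MvPolynomial {k : Fin r // k ≠ j} R, ∃ (ρ σ : R), σ ∉ 𝔭 ∧
      ψ σ * MvPolynomial.eval₂Hom ψ (fun k : {k : Fin r // k ≠ j} => e k.1) P - ψ ρ ∈ 𝔑 by
    obtain ⟨P, rfl⟩ := hgen d
    exact h P
  intro P
  induction P using MvPolynomial.induction_on with
  | C s =>
    refine ⟨s, 1, fun h => (‹𝔭.IsPrime›.ne_top ((Ideal.eq_top_iff_one _).mpr h)), ?_⟩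
    rw [MvPolynomial.eval₂Hom_C, map_one, one_mul, sub_self]
    exact 𝔑.zero_mem
  | add p q hp hq =>
    obtain ⟨ρ₁, σ₁, hσ₁, h₁⟩ := hp
    obtain ⟨ρ₂, σ₂, hσ₂, h₂⟩ := hq
    refine ⟨σ₂ * ρ₁ + σ₁ * ρ₂, σ₁ * σ₂, fun h => (‹𝔭.IsPrime›.mem_or_mem h).elim hσ₁ hσ₂, ?_⟩
    have : ψ (σ₁ * σ₂) * MvPolynomial.eval₂Hom ψ (fun k : {k : Fin r // k ≠ j} => e k.1) (p + q) -
          ψ (σ₂ * ρ₁ + σ₁ * ρ₂) =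
        ψ σ₂ * (ψ σ₁ * MvPolynomial.eval₂Hom ψ (fun k : {k : Fin r // k ≠ j} => e k.1) p - ψ ρ₁) +
          ψ σ₁ * (ψ σ₂ * MvPolynomial.eval₂Hom ψ (fun k : {k : Fin r // k ≠ j} => e k.1) q - ψ ρ₂) := by
      rw [map_add, map_add, map_mul, map_mul, map_mul]
      ring
    rw [this]
    exact 𝔑.add_mem (Ideal.mul_mem_left _ _ h₁) (Ideal.mul_mem_left _ _ h₂)
  | mul_X p k hp =>
    obtain ⟨ρ₁, σ₁, hσ₁, h₁⟩ := hp
    refine ⟨ρ₁ * (rs k.1).1, σ₁ * (rs k.1).2, fun h => (‹𝔭.IsPrime›.mem_or_mem h).elim hσ₁ (rs k.1).2.2, ?_⟩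
    have hk : ψ ((rs k.1).2 : R) * e k.1 - ψ (rs k.1).1 ∈ 𝔑 :=
      Ideal.mem_sup_right (Ideal.subset_span ⟨k.1, rfl⟩)
    have : ψ (σ₁ * (rs k.1).2) * MvPolynomial.eval₂Hom ψ (fun k : {k : Fin r // k ≠ j} => e k.1)
            (p * MvPolynomial.X k) - ψ (ρ₁ * (rs k.1).1) =
        ψ ((rs k.1).2 : R) * e k.1 *
            (ψ σ₁ * MvPolynomial.eval₂Hom ψ (fun k : {k : Fin r // k ≠ j} => e k.1) p - ψ ρ₁) +
          ψ ρ₁ * (ψ ((rs k.1).2 : R) * e k.1 - ψ (rs k.1).1) := by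
      simp only [map_mul, MvPolynomial.eval₂Hom_X']
      ring
    rw [this]
    exact 𝔑.add_mem (Ideal.mul_mem_left _ _ h₁) (Ideal.mul_mem_left _ _ hk)

/-- **Uniqueness of the rational point over a prime.** Two primes `w₁, w₂` of `D = R[e_k]` lying over the prime `𝔭 ⊆ R`
(`w_i ∩ R = 𝔭`) and containing `𝔑 = 𝔭·D + (ψ(s_k) e_k − ψ(r_k))_k` coincide: by `exists_sub_mem_rationalIdeal`, membership
`d ∈ w_i` is equivalent to `ρ_d ∈ 𝔭` for data `(ρ_d, σ_d)` not depending on `i`. (The unique point of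
`Spec((D/𝔑) ⊗_R k(𝔭)) = Spec k(𝔭)`.) [folklore; AI-written] -/
theorem eq_of_comap_eq_of_rationalIdeal_le
    (hgen : Function.Surjective (MvPolynomial.eval₂Hom ψ (fun k : {k : Fin r // k ≠ j} => e k.1)))
    {w₁ w₂ : Ideal D} [w₁.IsPrime] [w₂.IsPrime] (hw₁ : w₁.comap ψ = 𝔭) (hw₂ : w₂.comap ψ = 𝔭)
    (h₁ : 𝔭.map ψ ⊔ Ideal.span (Set.range fun k => ψ ((rs k).2 : R) * e k - ψ (rs k).1) ≤ w₁)
    (h₂ : 𝔭.map ψ ⊔ Ideal.span (Set.range fun k => ψ ((rs k).2 : R) * e k - ψ (rs k).1) ≤ w₂) :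
    w₁ = w₂ := by
  -- membership in a prime over `𝔭` containing `𝔑` is read off in `R`
  have key : ∀ (w : Ideal D) [w.IsPrime], w.comap ψ = 𝔭 →
      𝔭.map ψ ⊔ Ideal.span (Set.range fun k => ψ ((rs k).2 : R) * e k - ψ (rs k).1) ≤ w →
      ∀ (d : D) (ρ σ : R), σ ∉ 𝔭 →
        ψ σ * d - ψ ρ ∈ 𝔭.map ψ ⊔ Ideal.span (Set.range fun k => ψ ((rs k).2 : R) * e k - ψ (rs k).1) →
        (d ∈ w ↔ ρ ∈ 𝔭) := by
    intro w _ hw hle d ρ σ hσ hd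
    have hσw : ψ σ ∉ w := fun h => hσ (by rw [← hw]; exact Ideal.mem_comap.mpr h)
    constructor
    · intro hdw
      have h1 : ψ ρ ∈ w := by
        have h2 : ψ ρ = ψ σ * d - (ψ σ * d - ψ ρ) := by ring
        rw [h2]
        exact w.sub_mem (w.mul_mem_left _ hdw) (hle hd)
      rw [← hw]
      exact Ideal.mem_comap.mpr h1
    · intro hρ
      have h1 : ψ σ * d ∈ w := by
        have h2 : ψ σ * d = (ψ σ * d - ψ ρ) + ψ ρ := by ring
        rw [h2]
        exact w.add_mem (hle hd) (by rw [← hw] at hρ; exact Ideal.mem_comap.mp hρ)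
      exact ((‹w.IsPrime›.mem_or_mem h1).resolve_left hσw)
  ext d
  obtain ⟨ρ, σ, hσ, hd⟩ := exists_sub_mem_rationalIdeal ψ j e 𝔭 rs hgen d
  rw [key w₁ hw₁ h₁ d ρ σ hσ hd, key w₂ hw₂ h₂ d ρ σ hσ hd]

end Rational

/-! ## The point of a chart with prescribed rational ratios, over a PRIME `𝔭` -/

/-- **A point of a chart `Spec D = Spec R[I/c_j]` at which every ratio `e_k = c_k/c_j` takes a prescribed value
`r_k/s_k ∈ k(𝔭)` contains the ideal `𝔑 = 𝔭·D + (ψ(s_k) e_k − ψ(r_k))_k`.** Generalisation of (the first half of) the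
private `asIdeal_eq_and_isIso_of_chart` of `ProjDirLine.lean` from a MAXIMAL to a PRIME ideal `𝔭 ⊆ R = Γ(X, U)` (the point
`x` of the centre need not be closed), stated for an ABSTRACT chart: `g : Spec D → X'` an open immersion with
`g ≫ π = Spec ψ ≫ (Spec R → X)`, elements `e_k ∈ D` with `ψ(c_k) = ψ(c_j) e_k`, `ψ(c_j)` a nonzerodivisor (the chart
`chartRing c j`); `w` a point of the chart over `𝔭`, `A = R_𝔭` with `φ : A → 𝒪_{X', g w}` extending `π^♯ ∘ germ`, and
`β_k = r_k/s_k ∈ A` with `φ(c_k) − φ(β_k)φ(c_j) ∈ φ(c_j)·𝔪`. Then `𝔑 ≤ w` — with `eq_of_comap_eq_of_rationalIdeal_le`: such a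
point is UNIQUE on the chart. Tools: the stalk map of `g` is an isomorphism and `𝒪_{Spec D, w} = D_w`.
[cite: StacksProject, Tag 0804; AI-written] -/
theorem rationalIdeal_le_of_chart {X' X : Scheme.{u}} (π : X' ⟶ X) (U : X.affineOpens)
    {D : CommRingCat.{u}} (ψ : Γ(X, U) ⟶ D) (g : Spec D ⟶ X') [IsOpenImmersion g]
    (hgπ : g ≫ π = Spec.map ψ ≫ U.2.fromSpec)
    {r : ℕ} (c : Fin r → Γ(X, U)) (j : Fin r) (e : Fin r → D)
    (hce : ∀ k, ψ.hom (c k) = ψ.hom (c j) * e k) (hcj : ψ.hom (c j) ∈ nonZeroDivisors D)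
    (w : Spec D) (hwU : π (g w) ∈ (U : X.Opens))
    (𝔭 : Ideal Γ(X, U)) [𝔭.IsPrime] (hw𝔭 : w.asIdeal.comap ψ.hom = 𝔭)
    {A : Type u} [CommRing A] [Algebra Γ(X, U) A]
    (φ : A →+* X'.presheaf.stalk (g w))
    (hφgerm : ∀ s : Γ(X, U), φ (algebraMap Γ(X, U) A s) =
      (π.stalkMap (g w)).hom ((X.presheaf.germ U (π (g w)) hwU).hom s))
    (β : Fin r → A) (rs : Fin r → Γ(X, U) × 𝔭.primeCompl)
    (hβ : ∀ k, φ (algebraMap Γ(X, U) A (c k)) - φ (β k) * φ (algebraMap Γ(X, U) A (c j)) ∈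
      Ideal.span {φ (algebraMap Γ(X, U) A (c j))} * maximalIdeal (X'.presheaf.stalk (g w)))
    (hrs : ∀ k, β k * algebraMap Γ(X, U) A (rs k).2 = algebraMap Γ(X, U) A (rs k).1) :
    𝔭.map ψ.hom ⊔ Ideal.span (Set.range fun k =>
        ψ.hom ((rs k).2 : Γ(X, U)) * e k - ψ.hom (rs k).1) ≤ w.asIdeal := by
  classical
  -- the local dictionary: `σ : B = 𝒪_{X', g w} ≅ L = 𝒪_{Spec D, w} = D_w`, `τ : D → L`
  let σ : ↑(X'.presheaf.stalk (g w)) ≃+* ↑((Spec D).presheaf.stalk w) :=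
    (asIso (g.stalkMap w)).commRingCatIsoToRingEquiv
  have hσ : ∀ b, σ b = (g.stalkMap w).hom b := fun _ => rfl
  let τ : D ⟶ (Spec D).presheaf.stalk w := (Scheme.ΓSpecIso D).inv ≫ (Spec D).presheaf.germ ⊤ w trivial
  letI : Algebra D ((Spec D).presheaf.stalk w) := τ.hom.toAlgebra
  haveI hlocL : IsLocalization.AtPrime ((Spec D).presheaf.stalk w) w.asIdeal :=
    StructureSheaf.IsLocalization.to_stalk (R := D) w
  have hστ : ∀ s : Γ(X, U), σ (φ (algebraMap Γ(X, U) A s)) = τ.hom (ψ.hom s) := by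
    intro s
    rw [hφgerm, hσ]
    exact stalkMap_stalkMap_germ_of_chart' π U g ψ hgπ w hwU s
  have hσm : ∀ b, b ∈ maximalIdeal (X'.presheaf.stalk (g w)) ↔ σ b ∈ maximalIdeal ((Spec D).presheaf.stalk w) := by
    intro b
    rw [mem_maximalIdeal, mem_maximalIdeal, mem_nonunits_iff, mem_nonunits_iff, MulEquiv.isUnit_map σ]
  have hτw : ∀ d : D, d ∈ w.asIdeal ↔ τ.hom d ∈ maximalIdeal ((Spec D).presheaf.stalk w) :=
    fun d => (IsLocalization.AtPrime.to_map_mem_maximal_iff ((Spec D).presheaf.stalk w) w.asIdeal d).symm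
  -- `ψ(c_j)` is a nonzerodivisor of `L`
  have hreg : τ.hom (ψ.hom (c j)) ∈ nonZeroDivisors ((Spec D).presheaf.stalk w) :=
    map_mem_nonZeroDivisors_of_isLocalization w.asIdeal.primeCompl ((Spec D).presheaf.stalk w) hcj
  refine sup_le ?_ ?_
  · rw [Ideal.map_le_iff_le_comap, hw𝔭]
  · rw [Ideal.span_le]
    rintro _ ⟨k, rfl⟩
    -- `c_k ≡ β_k c_j` at the point, read in `L`
    obtain ⟨m, hm, hmk⟩ := Ideal.mem_span_singleton_mul.mp (hβ k)
    have h := congrArg σ hmk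
    rw [map_mul, map_sub, map_mul, hστ, hστ, hce k, map_mul] at h
    have e1 : (τ.hom (e k) - σ (φ (β k)) - σ m) * τ.hom (ψ.hom (c j)) = 0 := by
      calc _ = (τ.hom (ψ.hom (c j)) * τ.hom (e k) - σ (φ (β k)) * τ.hom (ψ.hom (c j))) -
          τ.hom (ψ.hom (c j)) * σ m := by ring
        _ = 0 := by rw [← h, sub_self]
    have e2 : τ.hom (e k) = σ (φ (β k)) + σ m := by
      have h0 := (mem_nonZeroDivisors_iff_right.mp hreg) _ e1
      rw [sub_sub, sub_eq_zero] at h0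
      exact h0
    have e3 : σ (φ (β k)) * τ.hom (ψ.hom (rs k).2) = τ.hom (ψ.hom (rs k).1) := by
      rw [← hστ, ← hστ, ← map_mul, ← map_mul, hrs k]
    have e4 : τ.hom (ψ.hom ((rs k).2 : Γ(X, U)) * e k - ψ.hom (rs k).1) = τ.hom (ψ.hom (rs k).2) * σ m := by
      rw [map_sub, map_mul, e2, ← e3]
      ring
    rw [SetLike.mem_coe, hτw, e4]
    exact Ideal.mul_mem_left _ _ ((hσm m).mp hm)

/-- **The residue field of a `k(x)`-rational point of a chart is `k(x)`** (CJS p. 103 L32 «if `e^O_x(X) ≤ 1` then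
`k(y) = k(x)`», here over a non-closed `x` as well): in the setting of `rationalIdeal_le_of_chart`, if the prime `w`
over `𝔭` CONTAINS `𝔑 = 𝔭·D + (ψ(s_k) e_k − ψ(r_k))_k` and `D` is generated over `R` by the `e_k` (`k ≠ j`), and `φ` takes
values in the image of `π^♯_{g w}` (`A = R_𝔭 ≅ 𝒪_{X,x}`), then `k(x) → k(g w)` is onto, i.e. `π.residueFieldMap (g w)` is
an isomorphism: every `b ∈ 𝒪_{X', g w}` is `≡ φ(ρ_d σ_s / ρ_s σ_d)` modulo `𝔪` (`exists_sub_mem_rationalIdeal` for a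
fraction `d/s` representing `b`). Second half of the private `asIdeal_eq_and_isIso_of_chart` of `ProjDirLine.lean`,
generalised from maximal to prime `𝔭`. [cite: CossartJannsenSaito2020, p. 103 L32; StacksProject, Tag 0804; AI-written] -/
theorem isIso_residueFieldMap_of_chart {X' X : Scheme.{u}} (π : X' ⟶ X) (U : X.affineOpens)
    {D : CommRingCat.{u}} (ψ : Γ(X, U) ⟶ D) (g : Spec D ⟶ X') [IsOpenImmersion g]
    (hgπ : g ≫ π = Spec.map ψ ≫ U.2.fromSpec)
    {r : ℕ} (j : Fin r) (e : Fin r → D)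
    (hgen : Function.Surjective (MvPolynomial.eval₂Hom ψ.hom (fun k : {k : Fin r // k ≠ j} => e k.1)))
    (w : Spec D) (hwU : π (g w) ∈ (U : X.Opens))
    (𝔭 : Ideal Γ(X, U)) [𝔭.IsPrime] (hw𝔭 : w.asIdeal.comap ψ.hom = 𝔭)
    {A : Type u} [CommRing A] [Algebra Γ(X, U) A] [IsLocalization.AtPrime A 𝔭]
    (φ : A →+* X'.presheaf.stalk (g w))
    (hφgerm : ∀ s : Γ(X, U), φ (algebraMap Γ(X, U) A s) =
      (π.stalkMap (g w)).hom ((X.presheaf.germ U (π (g w)) hwU).hom s))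
    (rs : Fin r → Γ(X, U) × 𝔭.primeCompl)
    (hN1 : 𝔭.map ψ.hom ⊔ Ideal.span (Set.range fun k =>
        ψ.hom ((rs k).2 : Γ(X, U)) * e k - ψ.hom (rs k).1) ≤ w.asIdeal)
    (hφlift : ∀ a₀ : A, ∃ a' : X.presheaf.stalk (π (g w)), (π.stalkMap (g w)).hom a' = φ a₀) :
    IsIso (π.residueFieldMap (g w)) := by
  classical
  -- the local dictionary: `σ : B = 𝒪_{X', g w} ≅ L = 𝒪_{Spec D, w} = D_w`, `τ : D → L`
  let σ : ↑(X'.presheaf.stalk (g w)) ≃+* ↑((Spec D).presheaf.stalk w) :=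
    (asIso (g.stalkMap w)).commRingCatIsoToRingEquiv
  have hσ : ∀ b, σ b = (g.stalkMap w).hom b := fun _ => rfl
  let τ : D ⟶ (Spec D).presheaf.stalk w := (Scheme.ΓSpecIso D).inv ≫ (Spec D).presheaf.germ ⊤ w trivial
  letI : Algebra D ((Spec D).presheaf.stalk w) := τ.hom.toAlgebra
  haveI hlocL : IsLocalization.AtPrime ((Spec D).presheaf.stalk w) w.asIdeal :=
    StructureSheaf.IsLocalization.to_stalk (R := D) w
  have hστ : ∀ s : Γ(X, U), σ (φ (algebraMap Γ(X, U) A s)) = τ.hom (ψ.hom s) := by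
    intro s
    rw [hφgerm, hσ]
    exact stalkMap_stalkMap_germ_of_chart' π U g ψ hgπ w hwU s
  have hσm : ∀ b, b ∈ maximalIdeal (X'.presheaf.stalk (g w)) ↔ σ b ∈ maximalIdeal ((Spec D).presheaf.stalk w) := by
    intro b
    rw [mem_maximalIdeal, mem_maximalIdeal, mem_nonunits_iff, mem_nonunits_iff, MulEquiv.isUnit_map σ]
  have hτw : ∀ d : D, d ∈ w.asIdeal ↔ τ.hom d ∈ maximalIdeal ((Spec D).presheaf.stalk w) :=
    fun d => (IsLocalization.AtPrime.to_map_mem_maximal_iff ((Spec D).presheaf.stalk w) w.asIdeal d).symm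
  -- (e) every `b ∈ 𝒪_{X', g w}` is `≡ φ(a)` modulo the maximal ideal, for some `a ∈ A = R_𝔭`
  have hres : ∀ b : X'.presheaf.stalk (g w), ∃ a : A, b - φ a ∈ maximalIdeal (X'.presheaf.stalk (g w)) := by
    intro b
    obtain ⟨⟨d, s⟩, hds⟩ := IsLocalization.surj w.asIdeal.primeCompl (σ b)
    have hds' : σ b * τ.hom (s : D) = τ.hom d := hds
    obtain ⟨ρd, σd, hσd, hd⟩ := exists_sub_mem_rationalIdeal ψ.hom j e 𝔭 rs hgen d
    obtain ⟨ρs, σs, hσs, hs⟩ := exists_sub_mem_rationalIdeal ψ.hom j e 𝔭 rs hgen (s : D)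
    have hd' : τ.hom (ψ.hom σd) * τ.hom d - τ.hom (ψ.hom ρd) ∈ maximalIdeal ((Spec D).presheaf.stalk w) := by
      have h1 := (hτw _).mp (hN1 hd)
      rwa [map_sub, map_mul] at h1
    have hs' : τ.hom (ψ.hom σs) * τ.hom (s : D) - τ.hom (ψ.hom ρs) ∈ maximalIdeal ((Spec D).presheaf.stalk w) := by
      have h1 := (hτw _).mp (hN1 hs)
      rwa [map_sub, map_mul] at h1
    -- `ρ_s ∉ 𝔭` since `s ∉ w`
    have hρs : ρs ∉ 𝔭 := by
      intro hρ
      apply s.2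
      have h1 : ψ.hom σs * (s : D) ∈ w.asIdeal := by
        have h2 : ψ.hom σs * (s : D) = (ψ.hom σs * (s : D) - ψ.hom ρs) + ψ.hom ρs := by ring
        rw [h2]
        refine w.asIdeal.add_mem (hN1 hs) ?_
        rw [← hw𝔭] at hρ
        exact Ideal.mem_comap.mp hρ
      have hσsw : ψ.hom σs ∉ w.asIdeal := fun h => hσs (by rw [← hw𝔭]; exact Ideal.mem_comap.mpr h)
      exact (w.isPrime.mem_or_mem h1).resolve_left hσsw
    have hu1 : IsUnit (algebraMap Γ(X, U) A (ρs * σd)) :=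
      IsLocalization.map_units A ⟨ρs * σd, show ρs * σd ∈ 𝔭.primeCompl from
        fun h => ((‹𝔭.IsPrime›.mem_or_mem h).elim hρs hσd)⟩
    refine ⟨algebraMap Γ(X, U) A (ρd * σs) * ↑(hu1.unit⁻¹), ?_⟩
    -- `b φ(ρ_s σ_d) - φ(ρ_d σ_s) ∈ 𝔪_B`
    have hmem : b * φ (algebraMap Γ(X, U) A (ρs * σd)) - φ (algebraMap Γ(X, U) A (ρd * σs)) ∈
        maximalIdeal (X'.presheaf.stalk (g w)) := by
      rw [hσm, map_sub, map_mul, hστ, hστ, map_mul, map_mul, map_mul, map_mul]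
      have h2 : σ b * (τ.hom (ψ.hom ρs) * τ.hom (ψ.hom σd)) - τ.hom (ψ.hom ρd) * τ.hom (ψ.hom σs) =
          τ.hom (ψ.hom σs) * (τ.hom (ψ.hom σd) * (σ b * τ.hom (s : D)) - τ.hom (ψ.hom ρd)) -
            σ b * τ.hom (ψ.hom σd) * (τ.hom (ψ.hom σs) * τ.hom (s : D) - τ.hom (ψ.hom ρs)) := by
        ring
      rw [h2, hds']
      exact Ideal.sub_mem _ (Ideal.mul_mem_left _ _ hd') (Ideal.mul_mem_left _ _ hs')
    have hu : φ (algebraMap Γ(X, U) A (ρs * σd)) * φ ↑(hu1.unit⁻¹) = 1 := by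
      rw [← map_mul, IsUnit.mul_val_inv, map_one]
    have h3 : b - φ (algebraMap Γ(X, U) A (ρd * σs) * ↑(hu1.unit⁻¹)) =
        (b * φ (algebraMap Γ(X, U) A (ρs * σd)) - φ (algebraMap Γ(X, U) A (ρd * σs))) * φ ↑(hu1.unit⁻¹) := by
      rw [map_mul φ (algebraMap Γ(X, U) A (ρd * σs)), sub_mul, mul_assoc, hu, mul_one]
    rw [h3]
    exact Ideal.mul_mem_right _ _ hmem
  -- (f) `k(π(g w)) → k(g w)` is onto, hence an isomorphism
  have hsurj : Function.Surjective (π.residueFieldMap (g w)).hom := by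
    intro q
    obtain ⟨b, hb⟩ : ∃ b, (X'.residue (g w)).hom b = q := Ideal.Quotient.mk_surjective q
    refine (hres b).elim fun a₀ ha₀ => ?_
    refine (hφlift a₀).elim fun a' ha' => ⟨(X.residue (π (g w))).hom a', ?_⟩
    have h1 : (π.residueFieldMap (g w)).hom ((X.residue (π (g w))).hom a') =
        (X'.residue (g w)).hom ((π.stalkMap (g w)).hom a') := by
      change (X.residue (π (g w)) ≫ π.residueFieldMap (g w)).hom a' =
        (π.stalkMap (g w) ≫ X'.residue (g w)).hom a'
      rw [Scheme.residue_residueFieldMap]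
    rw [h1, ← hb, ha']
    change IsLocalRing.residue _ (φ a₀) = IsLocalRing.residue _ b
    rw [← sub_eq_zero, ← map_sub, IsLocalRing.residue_eq_zero_iff, ← Ideal.neg_mem_iff, neg_sub]
    exact ha₀
  have hbij : Function.Bijective (π.residueFieldMap (g w)).hom :=
    ⟨(π.residueFieldMap (g w)).hom.injective, hsurj⟩
  exact (RingEquiv.ofBijective _ hbij).toCommRingCatIso.isIso_hom

end Summit.ResolutionOfSingularities.ResolutionOfSingularities.Theorems.SigmaMaxModificationsCorridor3.Directrix214Sharp

end
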